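import Literature.NumberTheory.EllipticCurves.SingularModuliRingClassUnramified
import Literature.NumberTheory.EllipticCurves.SingularModuliWeberCubeRootInert
import Literature.NumberTheory.EllipticCurves.SingularModuliWeberSquareRootInert
import Literature.NumberTheory.NumberFields.IdealPowerOfUnramifiedRoot
import HarnessLib

/-!
# `(j(τ_{d_K}))` is a cube away from `3` and `(j(τ_{d_K}) − 1728)` a square away from `2`, for every
# imaginary quadratic field (Cox, *Primes of the form x² + ny²*, §12, through the ring class fields of
# conductor `3` and `2`)

Topic `NumberTheory/EllipticCurves` (complex multiplication).  Theorem-only file (no definition, no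
named fact).  For `K` imaginary quadratic, `H_K = singularModuliField K ι ⊂ ℂ` its field of singular
moduli (≅ the Hilbert class field) and `j₁ ∈ 𝓞_{H_K}` over `j(τ_{d_K})`:

* `three_dvd_count_span_formJ` — **every prime `𝔓 ∌ 3` of `𝓞_{H_K}` has exponent `≡ 0 (mod 3)` in
  `(j₁)`**, for ALL `d_K`;
* `two_dvd_count_span_formJ_sub` — **every prime `𝔓 ∌ 2` of `𝓞_{H_K}` has even exponent in
  `(j₁ − 1728)`**, for ALL `d_K`.

For `3 ∤ d_K` (resp. `d_K` odd) the tree already has the ideal equalities `(j₁) = (w)³`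
(`exists_span_formJ_eq_pow_three_of_not_dvd`) resp. `(j₁ − 1728) = 𝔟²`
(`exists_span_formJ_sub_eq_sq_of_odd`).  In the remaining cases Weber's functions do not take values
in `H_K`: `γ₂(τ₀) = u₉(P)`, `P = (τ₀ + 1)/3 ↔ (9, 9b − 6, 1 − 3b + c)` a proper ideal of the order of
conductor `3`, lies in `H_K(j(P))`, and `γ₃(τ₀) = u₄(τ₀/2)`, `τ₀/2 ↔ (4, 2b, c)` (order of
conductor `2`), lies in `H_K(j(τ₀/2))` (level-`9` / level-`4` transport, `weberFourValue_half_mem_adjoin`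
and its level-`9` analogue `weberNineValue_shift_mem_adjoin` here); these extensions are unramified
over `H_K` outside `3` resp. `2` (`isUnramifiedIn_adjoin_formJ_conductor`: they lie in the ray class
field `mod 3`, resp. `mod 2`, Cox §9.A with Thm. 11.1), so `v_𝔓(j₁) = 3 v_𝔔(γ₂)` and
`v_𝔓(j₁ − 1728) = 2 v_𝔔(γ₃)` at every prime `𝔔 ∣ 𝔓` upstairs
(`dvd_count_of_eq_pow_of_isUnramifiedIn`).  The primes above `3` (cube) and `2` (square) are the
subject of a sequel (level-`2` and level-`3` Hauptmoduln).

## References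

* D. A. Cox, *Primes of the form x² + ny²*, 2nd ed., Wiley 2013: §12.A Thm. 12.2 and the proof of
  (12.10); §9.A (ring class fields); §11.A Thm. 11.1. [Cox2013]
* G. Shimura, *Introduction to the arithmetic theory of automorphic functions* (1971), §6.8 (values
  of rational modular functions at CM points). [ShimuraIATAF1971]
* J. Neukirch, *Algebraic Number Theory* (1999), Ch. I §8; Ch. VI (6.2)–(6.3). [NeukirchANT1999]
-/

noncomputable section

open Complex Polynomial IntermediateField NumberField IsDedekindDomain
open UpperHalfPlane hiding I
open scoped MatrixGroups Modular Cardinal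

namespace Literature.NumberTheory.EllipticCurves

open ModularForms
open Literature.NumberTheory.NumberFields
open Literature.FieldTheory.AlgClosed
open Literature.NumberTheory.QuadraticFields.BinaryQuadraticForm
open Literature.NumberTheory.QuadraticFields.Quadratic (discr_emod_four)

/-! ### Forms `(1, B, C)` of the same discriminant have the same `j` -/

section Translate

/-- **`j(τ_{(1,B,C)}) = j(τ_{(1,B',C')})` when `B² − 4C = B'² − 4C' < 0`**: the two points differ by
the integer translation `(B − B')/2`, and `j` is `SL₂(ℤ)`-invariant (`kleinJ_smul`). [folklore] -/
theorem formJ_one_eq_of_discr_eq {B C B' C' : ℤ} (hD : B ^ 2 - 4 * C < 0)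
    (h : B ^ 2 - 4 * C = B' ^ 2 - 4 * C') :
    formJ ((1 : ℤ), B, C) = formJ ((1 : ℤ), B', C') := by
  -- `B ≡ B' (mod 2)`
  have heven : Even (B - B') := by
    by_contra hodd
    rw [Int.not_even_iff_odd] at hodd
    have hodd' : Odd (B + B') := by
      have e : B + B' = (B - B') + 2 * B' := by ring
      rw [e]; exact hodd.add_even (even_two_mul B')
    have h4 : Even ((B - B') * (B + B')) := ⟨2 * (C - C'), by linear_combination h⟩
    exact Int.not_even_iff_odd.mpr (hodd.mul hodd') h4
  obtain ⟨k, hk⟩ := heven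
  have hD' : B' ^ 2 - 4 * C' < 0 := h ▸ hD
  have hpt : heegnerTau ((1 : ℤ), B', C') = ModularGroup.T ^ k • heegnerTau ((1 : ℤ), B, C) := by
    apply UpperHalfPlane.ext
    rw [UpperHalfPlane.modular_T_zpow_smul, UpperHalfPlane.coe_vadd,
      coe_heegnerTau_eq (Q := ((1 : ℤ), B, C)) (D := B ^ 2 - 4 * C) one_pos (by push_cast; ring) hD,
      coe_heegnerTau_eq (Q := ((1 : ℤ), B', C')) (D := B ^ 2 - 4 * C) one_pos
        (by push_cast; linear_combination -h) hD]
    have hk' : (B' : ℂ) = B - 2 * k := by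
      have : (B' : ℤ) = B - (k + k) := by omega
      rw [this]; push_cast; ring
    rw [hk']
    push_cast
    ring
  rw [formJ_eq_kleinJ, formJ_eq_kleinJ, hpt, kleinJ_smul]

/-- `j(τ_{(1, B, C)}) = j(τ_{d})` for the principal form of discriminant `d = B² − 4C < 0`. [folklore] -/
theorem formJ_one_eq_formJ_principalForm {B C : ℤ} (hD : B ^ 2 - 4 * C < 0) :
    formJ ((1 : ℤ), B, C) = formJ (principalForm (B ^ 2 - 4 * C)) := by
  set D := B ^ 2 - 4 * C with hDdef
  have h4 : D % 4 = 0 ∨ D % 4 = 1 := by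
    rcases Int.even_or_odd B with ⟨m, rfl⟩ | ⟨m, rfl⟩
    · left
      have e : (m + m) ^ 2 - 4 * C = 4 * (m ^ 2 - C) := by ring
      rw [hDdef, e]; exact Int.mul_emod_right _ _
    · right
      have e : (2 * m + 1) ^ 2 - 4 * C = 4 * (m ^ 2 + m - C) + 1 := by ring
      rw [hDdef, e]; omega
  have hP := discr_principalForm h4
  have hP1 := principalForm_fst D
  rcases hQ : principalForm D with ⟨P1, P2, P3⟩
  rw [hQ] at hP hP1
  change P1 = 1 at hP1
  subst hP1
  rw [QuadraticFields.BinaryQuadraticForm.discr_apply] at hP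
  exact formJ_one_eq_of_discr_eq hD (by linear_combination -hP)

end Translate

/-! ### The level-`9` point `P = (τ₀ + 1)/3 ↔ (9, 9b − 6, 1 − 3b + c)` when `3 ∣ c` -/

section LevelNine

variable {b c : ℤ}

/-- `1 − 3b + c` is prime to `3` when `3 ∣ c`. [folklore] -/
theorem not_three_dvd_shiftCoeff (hc : (3 : ℤ) ∣ c) : ¬ (3 : ℤ) ∣ 1 - 3 * b + c := by
  intro h; omega

/-- `(9, 9b − 6, 1 − 3b + c) ∈ heegnerForms 9 (9D)`, `D = 9b² − 4c`, when `3 ∣ c`: the CM point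
`(τ₀ + 1)/3` of level `9`, a proper ideal of the order of conductor `3` (the lattice `[3, τ₀ + 1]` has
multiplier ring `ℤ + 3𝓞_K` when `3` ramifies). [cite: Cox2013, §12.A proof of Thm. 12.2] -/
theorem nine_shift_mem_heegnerForms (hc : (3 : ℤ) ∣ c) :
    ((9 : ℤ), 9 * b - 6, 1 - 3 * b + c) ∈ heegnerForms 9 (9 * (9 * b ^ 2 - 4 * c)) := by
  refine ⟨by push_cast; ring, by norm_num, by norm_num, ?_⟩
  intro d hdA _ hdC
  exact (isCoprime_nine_of_not_dvd (not_three_dvd_shiftCoeff hc)).isUnit_of_dvd' hdA hdC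

/-- `(9, 9b − 6, 1 − 3b + c)` is primitive of discriminant `9D`. [folklore] -/
theorem nine_shift_spec (hc : (3 : ℤ) ∣ c) :
    0 < ((9 : ℤ), 9 * b - 6, 1 - 3 * b + c).1 ∧ IsPrimitive ((9 : ℤ), 9 * b - 6, 1 - 3 * b + c) ∧
      discr ((9 : ℤ), 9 * b - 6, 1 - 3 * b + c) = 9 * (9 * b ^ 2 - 4 * c) := by
  refine ⟨by norm_num, isPrimitive_of_isCoprime (isCoprime_nine_of_not_dvd (not_three_dvd_shiftCoeff hc)), ?_⟩
  rw [QuadraticFields.BinaryQuadraticForm.discr_apply]; ring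

/-- `3 · P = τ₀ + 1`: `tpD 3 • τ_{(9, 9b−6, 1−3b+c)} = τ_{(1, 3b − 2, 1 − 3b + c)}`. [folklore] -/
theorem tpD_three_smul_heegnerTau_shift (hD : 9 * b ^ 2 - 4 * c < 0) :
    tpD 3 • heegnerTau ((9 : ℤ), 9 * b - 6, 1 - 3 * b + c) =
      heegnerTau ((1 : ℤ), 3 * b - 2, 1 - 3 * b + c) := by
  apply UpperHalfPlane.ext
  rw [coe_tpD_smul,
    coe_heegnerTau_eq (Q := ((1 : ℤ), 3 * b - 2, 1 - 3 * b + c)) (D := 9 * b ^ 2 - 4 * c) one_pos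
      (by push_cast; ring) hD,
    coe_heegnerTau_eq (Q := ((9 : ℤ), 9 * b - 6, 1 - 3 * b + c)) (D := 9 * (9 * b ^ 2 - 4 * c))
      (by norm_num) (by push_cast; ring) (by linarith), sqrtDisc_nine_mul]
  push_cast
  ring

/-- `u₉(P)³ = j(3P) = j(τ₀ + 1) = j(τ₀)` for `τ₀ = τ_{(1, 3b, c)}`. [cite: Cox2013, §12.A (`γ₂³ = j`)] -/
theorem weberNineValue_shift_pow_three (hD : 9 * b ^ 2 - 4 * c < 0) :
    weberNineValue (heegnerTau ((9 : ℤ), 9 * b - 6, 1 - 3 * b + c)) ^ 3 = formJ ((1 : ℤ), 3 * b, c) := by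
  rw [weberNineValue_pow_three, tpD_three_smul_heegnerTau_shift hD, ← formJ_eq_kleinJ]
  exact formJ_one_eq_of_discr_eq (by nlinarith) (by ring)

/-- An automorphism of `ℂ` fixing `√D` and `x = j(P)` fixes `u₉(P)`: level-`9` transport at `P`
(`levelTransport_self_of_apply_formJ_eq_of_fst_eq`, `gcd(9, 1 − 3b + c) = 1`) and `Aut(ℂ)`-invariance
of the `q`-series of `u₉ = γ₂(3τ)` (`mapLaurent_weberNineFn`).
[cite: Cox2013, §12.A proof of Thm. 12.2 ((12.10))] [cite: ShimuraIATAF1971, §6.8] -/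
theorem apply_weberNineValue_shift_eq (hD : 9 * b ^ 2 - 4 * c < 0) (hc : (3 : ℤ) ∣ c)
    {σ : ℂ ≃+* ℂ} (hσ : σ (sqrtDisc (9 * b ^ 2 - 4 * c)) = sqrtDisc (9 * b ^ 2 - 4 * c))
    (hx : σ (formJ ((9 : ℤ), 9 * b - 6, 1 - 3 * b + c)) = formJ ((9 : ℤ), 9 * b - 6, 1 - 3 * b + c)) :
    σ (weberNineValue (heegnerTau ((9 : ℤ), 9 * b - 6, 1 - 3 * b + c))) =
      weberNineValue (heegnerTau ((9 : ℤ), 9 * b - 6, 1 - 3 * b + c)) := by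
  have hσ9 : σ (sqrtDisc (9 * (9 * b ^ 2 - 4 * c))) = sqrtDisc (9 * (9 * b ^ 2 - 4 * c)) := by
    rw [sqrtDisc_nine_mul, map_mul, map_ofNat, hσ]
  have hT := levelTransport_self_of_apply_formJ_eq_of_fst_eq (N := 9) (by linarith)
    (nine_shift_mem_heegnerForms hc) rfl (isCoprime_nine_of_not_dvd (not_three_dvd_shiftCoeff hc)) hσ9 hx
  exact LevelTransport.apply_value_eq (N := 9) hT (mapLaurent_weberNineFn (σ : ℂ →+* ℂ))
    (pointValuation_weberNineFn_sub_lt_one _)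

variable {K : Type*} [Field K] [NumberField K]

/-- **`γ₂(τ₀) = u₉(P) ∈ H_K(j(P))`** for `τ₀ = τ_{(1, 3b, c)}` of discriminant `d_K` with `3 ∣ c`
(the case `3 ∣ d_K`): the fixed field of `Aut(ℂ/H_K(j(P)))` is `H_K(j(P))`, and such automorphisms fix
`√d_K ∈ H_K` (`apply_sqrtDisc_discr_eq`). [cite: Cox2013, §12.A proof of Thm. 12.2 ((12.10))] -/
theorem weberNineValue_shift_mem_adjoin (hK : IsImaginaryQuadratic K) (ι : K →+* ℂ)
    (hdisc : 9 * b ^ 2 - 4 * c = NumberField.discr K) (hc : (3 : ℤ) ∣ c) :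
    weberNineValue (heegnerTau ((9 : ℤ), 9 * b - 6, 1 - 3 * b + c)) ∈
      adjoin (singularModuliField K ι) ({formJ ((9 : ℤ), 9 * b - 6, 1 - 3 * b + c)} : Set ℂ) := by
  set H := singularModuliField K ι with hHdef
  set x := formJ ((9 : ℤ), 9 * b - 6, 1 - 3 * b + c) with hxdef
  have hD : 9 * b ^ 2 - 4 * c < 0 := by rw [hdisc]; exact hK.discr_neg
  have hrange : Set.range (algebraMap H ℂ) = (H : Set ℂ) := by
    ext z; constructor
    · rintro ⟨y, rfl⟩; exact y.2
    · intro hz; exact ⟨⟨z, hz⟩, rfl⟩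
  have hcount : #((adjoin H ({x} : Set ℂ)).toSubfield) ≤ ℵ₀ := by
    rw [adjoin_toSubfield]
    refine (Subfield.cardinalMk_closure_le_max _).trans (max_le ?_ le_rfl)
    refine (Cardinal.mk_union_le _ _).trans ?_
    rw [Cardinal.add_le_aleph0]
    exact ⟨Cardinal.mk_range_le.trans (cardinalMk_singularModuliField_le K hK ι), by simp⟩
  refine Complex.mem_subfield_of_forall_ringEquiv _ hcount fun σ hσ ↦ ?_
  have hfixH : ∀ z ∈ H, σ z = z := fun z hz ↦
    hσ z (by
      show z ∈ (adjoin H ({x} : Set ℂ)).toSubfield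
      rw [adjoin_toSubfield]
      exact Subfield.subset_closure (Or.inl (hrange ▸ hz)))
  have hσD : σ (sqrtDisc (9 * b ^ 2 - 4 * c)) = sqrtDisc (9 * b ^ 2 - 4 * c) := by
    have h := apply_sqrtDisc_discr_eq hK ι fun k ↦ hfixH _ (apply_mem_singularModuliField ι k)
    rwa [← hdisc] at h
  have hσx : σ x = x := hσ x (subset_adjoin H ({x} : Set ℂ) rfl)
  exact apply_weberNineValue_shift_eq hD hc hσD hσx

end LevelNine

/-! ### Main theorems -/

section Main

variable {K : Type} [Field K] [NumberField K]

/-- The exponent of `v` in `I = Jⁿ` is divisible by `n` (`I ≠ 0`). [folklore] -/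
theorem dvd_count_of_eq_pow {R : Type*} [CommRing R] [IsDedekindDomain R] {I J : Ideal R}
    (hI : I ≠ ⊥) {n : ℕ} (h : I = J ^ n) (v : HeightOneSpectrum R) :
    n ∣ (Associates.mk v.asIdeal).count (Associates.mk I).factors := by
  classical
  by_cases hJ : J = ⊥
  · rcases Nat.eq_zero_or_pos n with hn | hn
    · subst hn
      refine ⟨0, ?_⟩
      rw [pow_zero, Ideal.one_eq_top] at h
      rw [mul_zero, h, ← Ideal.one_eq_top, Associates.mk_one, Associates.factors_one,
        Associates.count_zero v.associates_irreducible]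
    · exfalso
      apply hI
      rw [h, hJ, ← Ideal.zero_eq_bot, zero_pow hn.ne']
  rw [h, Associates.mk_pow, Associates.count_pow (Associates.mk_ne_zero.mpr hJ) v.associates_irreducible]
  exact dvd_mul_right n _

/-- The exponent of `v` in `(a) = (w)ⁿ` is divisible by `n` (`a ≠ 0`). [folklore] -/
theorem dvd_count_of_span_eq_span_pow {R : Type*} [CommRing R] [IsDedekindDomain R] {a w : R}
    (ha : a ≠ 0) {n : ℕ} (h : Ideal.span {a} = Ideal.span {w} ^ n) (v : HeightOneSpectrum R) :
    n ∣ (Associates.mk v.asIdeal).count (Associates.mk (Ideal.span {a})).factors :=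
  dvd_count_of_eq_pow (by simpa [Ideal.span_singleton_eq_bot] using ha) h v

/-- **`3 ∣ v_𝔓(j₁)` for every prime `𝔓 ∌ 3` of `𝓞_{H_K}`**, `j₁ ∈ 𝓞_{H_K}` over `j(τ_{d_K})`, for every
imaginary quadratic `K` (`j₁ ≠ 0`, i.e. `d_K ≠ −3`).  For `3 ∤ d_K`, `(j₁) = (w)³` outright
(`exists_span_formJ_eq_pow_three_of_not_dvd`); for `3 ∣ d_K`, `j₁ = γ₂³` with
`γ₂ = u₉(P) ∈ H_K(j(P))`, `P ↔ (9, 9b − 6, 1 − 3b + c)` of discriminant `9d_K`, an extension of `H_K`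
unramified outside `3` (`isUnramifiedIn_adjoin_formJ_conductor`), so `v_𝔓(j₁) = 3 v_𝔔(γ₂)` at a prime
`𝔔 ∣ 𝔓` there. [cite: Cox2013, §12.A Thm. 12.2 and §9.A] [cite: NeukirchANT1999, Ch. I §8 Prop. 8.2] -/
theorem three_dvd_count_span_formJ (hK : IsImaginaryQuadratic K) (ι : K →+* ℂ)
    [NumberField (singularModuliField K ι)] (j₁ : 𝓞 (singularModuliField K ι))
    (hj₁ : ((j₁ : singularModuliField K ι) : ℂ) = formJ (principalForm (NumberField.discr K)))
    (hj0 : j₁ ≠ 0) (v : HeightOneSpectrum (𝓞 (singularModuliField K ι)))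
    (hv : ((3 : ℕ) : 𝓞 (singularModuliField K ι)) ∉ v.asIdeal) :
    3 ∣ (Associates.mk v.asIdeal).count (Associates.mk (Ideal.span {j₁})).factors := by
  set D := NumberField.discr K with hDdef
  have hD : D < 0 := hK.discr_neg
  have h4 : D % 4 = 0 ∨ D % 4 = 1 := discr_emod_four hK.1
  have hP1 : 0 < (principalForm D).1 := by rw [principalForm_fst]; exact one_pos
  by_cases h3 : (3 : ℤ) ∣ D
  swap
  · -- `3 ∤ d_K`: `(j₁) = (w)³`
    obtain ⟨w, hw⟩ := exists_span_formJ_eq_pow_three_of_not_dvd hK h3 ι hP1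
      (isPrimitive_principalForm D) (discr_principalForm h4) j₁ hj₁
    exact dvd_count_of_span_eq_span_pow hj0 hw v
  -- `3 ∣ d_K`: `τ₀ = τ_{(1, 3b, c)}` with `9b² − 4c = d_K`, `3 ∣ c`
  obtain ⟨b, c, hbc⟩ : ∃ b c : ℤ, 9 * b ^ 2 - 4 * c = D := by
    rcases h4 with h | h
    · exact ⟨0, -(D / 4), by omega⟩
    · exact ⟨-1, (9 - D) / 4, by omega⟩
  have hc : (3 : ℤ) ∣ c := by omega
  have hD' : 9 * b ^ 2 - 4 * c < 0 := hbc ▸ hD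
  obtain ⟨hA9, hprim9, hdisc9⟩ := nine_shift_spec (b := b) hc
  set x := formJ ((9 : ℤ), 9 * b - 6, 1 - 3 * b + c) with hxdef
  set M : IntermediateField (singularModuliField K ι) ℂ :=
    adjoin (singularModuliField K ι) ({x} : Set ℂ) with hMdef
  have h9D : 9 * (9 * b ^ 2 - 4 * c) < 0 := by linarith
  have hxint : IsIntegral ℤ x := isIntegral_int_formJ hA9 hprim9 (by rw [hdisc9]; exact h9D)
  haveI : FiniteDimensional (singularModuliField K ι) M :=
    adjoin.finiteDimensional (show IsIntegral ℚ x from hxint.tower_top).tower_top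
  haveI : FiniteDimensional ℚ M := Module.Finite.trans (singularModuliField K ι) M
  haveI : NumberField M := NumberField.mk
  -- `g = γ₂(τ₀) ∈ M`, `g³ = j(τ₀) = j(τ_{d_K})`
  set g := weberNineValue (heegnerTau ((9 : ℤ), 9 * b - 6, 1 - 3 * b + c)) with hgdef
  have hgM : g ∈ M := weberNineValue_shift_mem_adjoin hK ι hbc hc
  have hg3 : g ^ 3 = formJ (principalForm D) := by
    rw [hgdef, weberNineValue_shift_pow_three hD', formJ_one_eq_formJ_principalForm (by linarith)]
    congr 1
    rw [show (3 * b) ^ 2 - 4 * c = D by rw [← hbc]; ring]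
  have hjint : IsIntegral ℤ (formJ (principalForm D)) :=
    isIntegral_int_formJ hP1 (isPrimitive_principalForm D) (by rw [discr_principalForm h4]; exact hD)
  have hgint : IsIntegral ℤ g := IsIntegral.of_pow (by norm_num : 0 < 3) (by rw [hg3]; exact hjint)
  have hgintM : IsIntegral ℤ (⟨g, hgM⟩ : M) :=
    (isIntegral_algHom_iff (M.val.restrictScalars ℤ) Subtype.val_injective).mp hgint
  set g' : 𝓞 M := ⟨⟨g, hgM⟩, hgintM⟩ with hg'
  have hinj : Function.Injective ((algebraMap M ℂ).comp (algebraMap (𝓞 M) M)) :=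
    (algebraMap M ℂ).injective.comp RingOfIntegers.coe_injective
  have heq : algebraMap (𝓞 (singularModuliField K ι)) (𝓞 M) j₁ = g' ^ 3 := by
    apply hinj
    simp only [RingHom.coe_comp, Function.comp_apply, map_pow]
    have h1 : algebraMap M ℂ (algebraMap (𝓞 M) M
        (algebraMap (𝓞 (singularModuliField K ι)) (𝓞 M) j₁)) =
        ((j₁ : singularModuliField K ι) : ℂ) := rfl
    have h2 : algebraMap M ℂ (algebraMap (𝓞 M) M g') = g := rfl
    rw [h1, h2, hg3, hj₁]
  -- `M/H_K` is unramified at `v ∌ 3`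
  haveI := v.isMaximal
  have hdisc9' : discr ((9 : ℤ), 9 * b - 6, 1 - 3 * b + c) = ((3 : ℕ) : ℤ) ^ 2 * NumberField.discr K := by
    rw [hdisc9, ← hDdef, ← hbc]; push_cast; ring
  have hunr : Algebra.IsUnramifiedIn (𝓞 M) v.asIdeal :=
    isUnramifiedIn_adjoin_formJ_conductor (Q := ((9 : ℤ), 9 * b - 6, 1 - 3 * b + c)) hK ι (f := 3)
      (by norm_num) hA9 hprim9 hdisc9' v.asIdeal hv
  exact dvd_count_of_eq_pow_of_isUnramifiedIn (K := singularModuliField K ι) (L := M) hj0 heq v hunr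

/-- **`2 ∣ v_𝔓(j₁ − 1728)` for every prime `𝔓 ∌ 2` of `𝓞_{H_K}`**, `j₁ ∈ 𝓞_{H_K}` over `j(τ_{d_K})`,
for every imaginary quadratic `K` (`j₁ ≠ 1728`, i.e. `d_K ≠ −4`).  For odd `d_K`, `(j₁ − 1728) = 𝔟²`
outright (`exists_span_formJ_sub_eq_sq_of_odd`); for even `d_K`, `j₁ − 1728 = γ₃²` with
`γ₃ = u₄(τ₀/2) ∈ H_K(j(τ₀/2))`, `τ₀/2 ↔ (4, 2b, c)` of discriminant `4d_K` (`c` odd), an extension of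
`H_K` unramified outside `2` (`isUnramifiedIn_adjoin_formJ_conductor`), so
`v_𝔓(j₁ − 1728) = 2 v_𝔔(γ₃)` at a prime `𝔔 ∣ 𝔓` there.
[cite: Cox2013, §12.A (after Thm. 12.13, `γ₃`) and §9.A] [cite: NeukirchANT1999, Ch. I §8 Prop. 8.2] -/
theorem two_dvd_count_span_formJ_sub (hK : IsImaginaryQuadratic K) (ι : K →+* ℂ)
    [NumberField (singularModuliField K ι)] (j₁ : 𝓞 (singularModuliField K ι))
    (hj₁ : ((j₁ : singularModuliField K ι) : ℂ) = formJ (principalForm (NumberField.discr K)))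
    (hj0 : j₁ - 1728 ≠ 0) (v : HeightOneSpectrum (𝓞 (singularModuliField K ι)))
    (hv : ((2 : ℕ) : 𝓞 (singularModuliField K ι)) ∉ v.asIdeal) :
    2 ∣ (Associates.mk v.asIdeal).count (Associates.mk (Ideal.span {j₁ - 1728})).factors := by
  set D := NumberField.discr K with hDdef
  have hD : D < 0 := hK.discr_neg
  have h4 : D % 4 = 0 ∨ D % 4 = 1 := discr_emod_four hK.1
  have hP1 : 0 < (principalForm D).1 := by rw [principalForm_fst]; exact one_pos
  rcases Int.even_or_odd D with heven | hodd
  swap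
  · -- odd `d_K`: `(j₁ − 1728) = 𝔟²`
    obtain ⟨𝔟, h𝔟⟩ := exists_span_formJ_sub_eq_sq_of_odd hK hodd ι hP1 (isPrimitive_principalForm D)
      (discr_principalForm h4) j₁ hj₁
    exact dvd_count_of_eq_pow (by simpa [Ideal.span_singleton_eq_bot] using hj0) h𝔟 v
  -- even `d_K`: `τ₀ = τ_{(1, b, c)}`, `b² − 4c = d_K`, `c` odd
  have h40 : D % 4 = 0 := by rcases heven with ⟨k, hk⟩; omega
  obtain ⟨b, c, hbc, hco⟩ : ∃ b c : ℤ, b ^ 2 - 4 * c = D ∧ Odd c := by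
    by_cases h8 : D % 8 = 0
    · exact ⟨2, 1 - D / 4, by omega, ⟨-(D / 8), by omega⟩⟩
    · exact ⟨0, -(D / 4), by omega, ⟨-(D / 8) - 1, by omega⟩⟩
  have hD' : b ^ 2 - 4 * 1 * c < 0 := by linarith
  have hdisc1 : discr ((1 : ℤ), b, c) = NumberField.discr K := by
    rw [QuadraticFields.BinaryQuadraticForm.discr_apply, ← hDdef, ← hbc]; ring
  set x := formJ ((4 * 1 : ℤ), 2 * b, c) with hxdef
  set M : IntermediateField (singularModuliField K ι) ℂ :=
    adjoin (singularModuliField K ι) ({x} : Set ℂ) with hMdef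
  have h4D : 4 * (b ^ 2 - 4 * 1 * c) < 0 := by linarith
  have hprim4 : IsPrimitive ((4 * 1 : ℤ), 2 * b, c) := isPrimitive_half (isPrimitive_one b c) hco
  have hdisc4 : discr ((4 * 1 : ℤ), 2 * b, c) = 4 * (b ^ 2 - 4 * 1 * c) := by
    rw [QuadraticFields.BinaryQuadraticForm.discr_apply]; ring
  have hA4 : 0 < ((4 * 1 : ℤ), 2 * b, c).1 := by norm_num
  have hxint : IsIntegral ℤ x := isIntegral_int_formJ hA4 hprim4 (by rw [hdisc4]; exact h4D)
  haveI : FiniteDimensional (singularModuliField K ι) M :=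
    adjoin.finiteDimensional (show IsIntegral ℚ x from hxint.tower_top).tower_top
  haveI : FiniteDimensional ℚ M := Module.Finite.trans (singularModuliField K ι) M
  haveI : NumberField M := NumberField.mk
  -- `g = γ₃(τ₀) ∈ M`, `g² = j − 1728`
  set g := weberFourValue (heegnerTau ((4 * 1 : ℤ), 2 * b, c)) with hgdef
  have hgM : g ∈ M := weberFourValue_half_mem_adjoin hK ι one_pos (isPrimitive_one b c) hdisc1 odd_one hco
  have hg2 : g ^ 2 = formJ (principalForm D) - 1728 := by
    rw [hgdef, weberFourValue_half_sq one_pos hD', formJ_one_eq_formJ_principalForm (by linarith), hbc]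
  have hjint : IsIntegral ℤ (formJ (principalForm D)) :=
    isIntegral_int_formJ hP1 (isPrimitive_principalForm D) (by rw [discr_principalForm h4]; exact hD)
  have h1728 : IsIntegral ℤ (1728 : ℂ) := by
    have h := isIntegral_algebraMap (R := ℤ) (A := ℂ) (x := 1728)
    simpa using h
  have hgint : IsIntegral ℤ g := IsIntegral.of_pow (by norm_num : 0 < 2) (by rw [hg2]; exact hjint.sub h1728)
  have hgintM : IsIntegral ℤ (⟨g, hgM⟩ : M) :=
    (isIntegral_algHom_iff (M.val.restrictScalars ℤ) Subtype.val_injective).mp hgint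
  set g' : 𝓞 M := ⟨⟨g, hgM⟩, hgintM⟩ with hg'
  have hinj : Function.Injective ((algebraMap M ℂ).comp (algebraMap (𝓞 M) M)) :=
    (algebraMap M ℂ).injective.comp RingOfIntegers.coe_injective
  have heq : algebraMap (𝓞 (singularModuliField K ι)) (𝓞 M) (j₁ - 1728) = g' ^ 2 := by
    apply hinj
    simp only [RingHom.coe_comp, Function.comp_apply, map_sub, map_pow, map_ofNat]
    have h1 : algebraMap M ℂ (algebraMap (𝓞 M) M
        (algebraMap (𝓞 (singularModuliField K ι)) (𝓞 M) j₁)) =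
        ((j₁ : singularModuliField K ι) : ℂ) := rfl
    have h2 : algebraMap M ℂ (algebraMap (𝓞 M) M g') = g := rfl
    rw [h1, h2, hg2, hj₁]
  -- `M/H_K` is unramified at `v ∌ 2`
  haveI := v.isMaximal
  have hdisc4' : discr ((4 * 1 : ℤ), 2 * b, c) = ((2 : ℕ) : ℤ) ^ 2 * NumberField.discr K := by
    rw [hdisc4, ← hDdef, ← hbc]; push_cast; ring
  have hunr : Algebra.IsUnramifiedIn (𝓞 M) v.asIdeal :=
    isUnramifiedIn_adjoin_formJ_conductor (Q := ((4 * 1 : ℤ), 2 * b, c)) hK ι (f := 2)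
      (by norm_num) hA4 hprim4 hdisc4' v.asIdeal hv
  exact dvd_count_of_eq_pow_of_isUnramifiedIn (K := singularModuliField K ι) (L := M) hj0 heq v hunr

end Main

end Literature.NumberTheory.EllipticCurves

end
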